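import Summits.ABC.IUTFork.Thm311RealInd1StripOrbitSpan
import Summits.ABC.IUTFork.Thm311RealInd1StripPacketFloor
import Literature.IUT.LogVolume.PacketDifferent
import HarnessLib

/-!
# [IUTchIII] Thm 3.11 (i) (Ind1) on a TENSOR PACKET of genuine completions: the SPAN-LEVEL SLOT REACH — per factor `b`, the five-element
# strip set `1 ⊗ … ⊗ ψ_b ⊗ … ⊗ 1` reaches `⊗_{b' ≠ b} M_{b'} ⊗ C_i(M_b)·P_i^b` (modulo `JannsenWingbergTwists`)

PROOF-ONLY file (abc-iut cell, Cor. 3.12 sub-crew, TEAM R «identified-copies reading», seat abc-iut-c312-14 = R1, gen 23; row «R-TPLB» —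
the tensor-packet lower bound co-held per abc-iut-c312-1 gen 14 (2026-08-27 09:32:08Z) and ruled a TEAM-R deliverable by the C LEAD
(ruling C-R111, 09:34:57Z: «a SIZING line … no build before R18a lands»); built after R18a (`Thm311RealInd1StripLogLatticeBox`) landed,
on R18c's basis of record).  TAKES NO SIDE on [IUTchIII] Cor. 3.12.

WHY.  `Thm311RealInd1StripPacketFloor` §1 reaches PURE TENSORS of the single-place two-step orbit spans — enough for HULL radii, not
span-structured.  THIS FILE names the reach of print's (Ind1) strip part acting in ONE slot `b` of the genuine packet
`X = ⊗_{ℚ_p, j} K_{w_j}` (the factorwise action of `LDHGenuinePerImagePrintInd1`, every other slot fixed) as the submodule the sizing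
of record quotes — the five-element economy of `Thm311RealInd1StripOrbitSpan` §2, `{1, ψ_i, ψ'_i, ψ'_i ψ_i, ψ_i ψ'_i}`, transported
through the slot-`b` linear map `δ ↦ (⊗_j z_j)[b ↦ δ]`:

* **`exists_slot_planes_tprod_mem_of_orbit`** (ACTIVE slot `b`: `p ≠ 2`, `d_b = [K_{w_b}:ℚ_p] ≥ 3` ODD, modulo `hJW`; `M_b` and the
  PASSIVE slots: bare SETS, no shape hypothesis) — the Jannsen–Wingberg basis `y` of the rescaled slot field (plane vectors trace-zero,
  spanning `Ker Tr`) and realised plane transvections `ψ_i, ψ'_i ∈ Real.ind1StripOf w_b (galoisLog w_b)`, such that every additive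
  subgroup `N ≤ X` containing the pure-tensor box `⊗_j M_j` and its four slot-`b` images under `ψ_i, ψ'_i, ψ'_i ψ_i, ψ_i ψ'_i`
  contains `y^*_{(i,ε)}(x_b) • (⊗_j x_j)[b ↦ y_{(i,ε')}]` for every box element `x`, every plane `i` and all `ε, ε'` — additively the
  reach `⊗_{b' ≠ b} M_{b'} ⊗ C_i(M_b)·P_i^b`, `C_i(M_b)` the `ℤ`-span of BOTH plane-`i` coordinates of `M_b`,
  `P_i^b = ℤ y_{(i,0)} ⊕ ℤ y_{(i,1)}`;
* **`exists_slot_planes_tprod_mem_of_closure`** — the same conclusion from the ORBIT-CLOSURE hypothesis of `…PacketFloor` §1 (the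
  junction-friendly form: `N` closed under slot-`b` strip moves on pure tensors, as in p516014's factorwise `hg`);
* **`closure_slot_planes_le_of_orbit`** — the reach packaged as an `AddSubgroup.closure ≤ N` statement (the quotable span form);
* **`trace_tprod_eq_zero_of_slot`**, **`trace_smul_tprod_eq_zero_of_slot`** (UNCONDITIONAL) — a pure tensor with ONE trace-zero slot is
  trace-zero in `X` (`Tr_X(⊗ z_j) = Π_j Tr(z_j)`, `trace_purePacket`); so every reached vector is trace-zero and the slot reach lies
  INSIDE the packet ceiling `M + c·(log_p(R_I^×) ∩ Ker Tr_X)` of `Thm311RealInd1StripPacketCeiling` — consistency with the upper bound.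

READING (numbers about OUR typed objects): per factor `b` the print-(Ind1) slot moves reach, modulo Jannsen–Wingberg, the plane lattices
of slot `b` scaled by the plane contents of `M_b`, tensored with the untouched passive data — and, from slot `b` alone, NOTHING ELSE of
the packet trace-zero lattice: single-slot moves produce no cross-terms, so the slot-union `Σ_b ⊗_{b' ≠ b} M_{b'} ⊗ C_i(M_b)·P_i^b` is
in general a PROPER part of the trace-zero ceiling — the contentful gap (TEAM R currency) between print's factorwise licence and the
packet trace-zero lattice; the hull-level two-sided closure at all-tame-odd packets is `…PacketHullWashout` / `…PacketFloor` §2 and is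
not re-proved here.  HONEST SCOPE: conditional on `hJW : JannsenWingbergTwists` (displayed binder; a conditional theorem discharges
nothing it binds); OUR typing of print's (Ind1) (THE equivariant lift, THE logarithm, single-factor action as in p516014; F-B28-1
untouched); `d_b` even (mod `JannsenWingbergTwistsFirst`) and the exact slot value (non-collinear reduction, mod `hMC`) are the
GO-gated sequels of the sizing; nothing here computes a hull or a log-volume; no side taken on [IUTchIII] Cor. 3.12; NO abc claim.
[claim: Mochizuki2012, status: disputed]; [cite: Mochizuki2012, IUTchIII Thm. 3.11 (i) p. 154; Cor. 3.12 Step (xi) p. 183];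
[cite: Kondo2025OuterAutMLF, §2 Thm 2.3]; [cite: HoshiNishio2022OuterAutMLF, Lemma 2.3 (ii)]; [cite: JannsenWingberg1982, Thm 2 p.75];
[cite: DupuyHilado2025, §4.9, §4.12]. typed ≠ proved.
-/

set_option autoImplicit false

noncomputable section

open Metric Set Function
open scoped Pointwise TensorProduct

namespace Summit.ABC.IUTFork.Thm311.Real

open NumberField IsDedekindDomain Literature.NumberTheory.NumberFields Literature.IUT.LogVolume
open Literature.NumberTheory.GaloisRepresentations Literature.NumberTheory.GaloisRepresentations.Ultrametric
open Literature.AnabelianGeometry.AbsoluteAnabelian Literature.IUT.HodgeArakelov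
open Literature.IUT.HodgeArakelov.AbsTopMonoids

variable {K : Type} [Field K] [NumberField K] (p : ℕ) [hp : Fact p.Prime]
variable {I : Type} [Fintype I] [DecidableEq I] (w : I → HeightOneSpectrum (𝓞 K)) (hw : ∀ i, ((p : ℕ) : 𝓞 K) ∈ (w i).asIdeal)

/-! ## §1 The slot reach: five elements at slot `b` reach `⊗_{b' ≠ b} M_{b'} ⊗ C_i(M_b)·P_i^b` (modulo `JannsenWingbergTwists`) -/

omit [Fintype I] in
/-- **Per factor `b`, print's (Ind1) slot moves reach `⊗_{b' ≠ b} M_{b'} ⊗ C_i(M_b)·P_i^b` (modulo `JannsenWingbergTwists`).**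
At an ACTIVE slot `b` with `p ≠ 2` and `d_b = [K_{w_b}:ℚ_p] ≥ 3` ODD there are the Jannsen–Wingberg basis `y` of the rescaled slot
field (plane vectors trace-zero, spanning `Ker Tr`, radial coordinate of non-zero trace; the basis of record of R18c) and realised
plane transvections `ψ_i, ψ'_i ∈ Real.ind1StripOf w_b (galoisLog w_b)` such that: for ALL factor regions `M_j ⊆ K_{w_j}` (bare sets —
no shape hypothesis, neither on the active nor on the passive slots) and every additive subgroup `N` of the packet
`X = ⊗_{ℚ_p, j} K_{w_j}` containing the pure-tensor box `{⊗_j x_j : x_j ∈ M_j}` and its four slot-`b` images under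
`ψ_i, ψ'_i, ψ'_i ψ_i, ψ_i ψ'_i` (`1 ⊗ … ⊗ ψ ⊗ … ⊗ 1` on pure tensors — the factorwise action of `LDHGenuinePerImagePrintInd1`),
`N` contains `y^*_{(i,ε)}(x_b) • (⊗_j x_j)[b ↦ y_{(i,ε')}]` for every `x ∈ Π_j M_j`, every plane `i` and all `ε, ε' ∈ {0,1}` —
additively, slot `b`'s plane-`i` contents `C_i(M_b)` times the plane lattice `P_i^b`, tensored with the untouched passive entries:
the reach `⊗_{b' ≠ b} M_{b'} ⊗ C_i(M_b)·P_i^b` of the sizing of record.  Proof: the five-element economy of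
`Thm311RealInd1StripOrbitSpan` §2 applied to the singleton `{x_b}` through the slot-`b` pullback `N.comap (δ ↦ (⊗_j x_j)[b ↦ δ])`.
[claim: Mochizuki2012, status: disputed] [cite: Mochizuki2012, IUTchIII Thm. 3.11 (i) p. 154]
[cite: Kondo2025OuterAutMLF, §2 Thm 2.3] [cite: JannsenWingberg1982, Thm 2 p.75] -/
theorem exists_slot_planes_tprod_mem_of_orbit (hJW : JannsenWingbergTwists)
    (b : I) (hp2 : p ≠ 2) (h3 : 3 ≤ localDeg K (w b)) (hodd : Odd (localDeg K (w b))) :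
    ∃ (g : ℕ) (_ : localDeg K (w b) = 1 + 2 * g)
      (y : Module.Basis (Fin 1 ⊕ Fin g × Fin 2) ℚ_[p] (RescaledCompletion K p (w b) (hw b)))
      (ψ ψ' : Fin g → ((w b).adicCompletion K ≃+ (w b).adicCompletion K)),
      (∀ i, ψ i ∈ ind1StripOf (w b) (galoisLog (w b))) ∧
      (∀ i, ψ' i ∈ ind1StripOf (w b) (galoisLog (w b))) ∧
      (∀ iε : Fin g × Fin 2, Algebra.trace ℚ_[p] (RescaledCompletion K p (w b) (hw b)) (y (Sum.inr iε)) = 0) ∧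
      Submodule.span ℚ_[p] (Set.range fun iε : Fin g × Fin 2 => y (Sum.inr iε)) =
        LinearMap.ker (Algebra.trace ℚ_[p] (RescaledCompletion K p (w b) (hw b))) ∧
      Algebra.trace ℚ_[p] (RescaledCompletion K p (w b) (hw b)) (y (Sum.inl 0)) ≠ 0 ∧
      ∀ (M : ∀ j, Set ((w j).adicCompletion K))
        (N : AddSubgroup (PacketAlgebra p fun j => RescaledCompletion K p (w j) (hw j))),
        (∀ x : Π j, (w j).adicCompletion K, (∀ j, x j ∈ M j) →
          PiTensorProduct.tprod ℚ_[p] (fun j => RescaledCompletion.of K p (w j) (hw j) (x j)) ∈ N) →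
        (∀ (i : Fin g) (x : Π j, (w j).adicCompletion K), (∀ j, x j ∈ M j) →
          PiTensorProduct.tprod ℚ_[p] (Function.update (fun j => RescaledCompletion.of K p (w j) (hw j) (x j)) b
            (RescaledCompletion.of K p (w b) (hw b) (ψ i (x b)))) ∈ N ∧
          PiTensorProduct.tprod ℚ_[p] (Function.update (fun j => RescaledCompletion.of K p (w j) (hw j) (x j)) b
            (RescaledCompletion.of K p (w b) (hw b) (ψ' i (x b)))) ∈ N ∧
          PiTensorProduct.tprod ℚ_[p] (Function.update (fun j => RescaledCompletion.of K p (w j) (hw j) (x j)) b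
            (RescaledCompletion.of K p (w b) (hw b) (ψ' i (ψ i (x b))))) ∈ N ∧
          PiTensorProduct.tprod ℚ_[p] (Function.update (fun j => RescaledCompletion.of K p (w j) (hw j) (x j)) b
            (RescaledCompletion.of K p (w b) (hw b) (ψ i (ψ' i (x b))))) ∈ N) →
        ∀ (i : Fin g) (x : Π j, (w j).adicCompletion K), (∀ j, x j ∈ M j) → ∀ ε ε' : Fin 2,
          y.coord (Sum.inr (i, ε)) (RescaledCompletion.of K p (w b) (hw b) (x b)) •
            PiTensorProduct.tprod ℚ_[p] (Function.update (fun j => RescaledCompletion.of K p (w j) (hw j) (x j)) b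
              (y (Sum.inr (i, ε')))) ∈ N := by
  classical
  obtain ⟨g, hg, y, ψ, ψ', hψ, hψ', htr0, hspan, htr1, hmain⟩ :=
    exists_planes_smul_mem_of_orbit (w b) hJW p (hw b) hp2 h3 hodd
  refine ⟨g, hg, y, ψ, ψ', hψ, hψ', htr0, hspan, htr1, fun M N hbox horb i x hx ε ε' => ?_⟩
  -- the slot-`b` linear map `δ ↦ (⊗_j z_j)[b ↦ δ]` along the pure tensor of the box element `x`
  set φ : RescaledCompletion K p (w b) (hw b) →ₗ[ℚ_[p]]
      PacketAlgebra p (fun j => RescaledCompletion K p (w j) (hw j)) :=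
    (PiTensorProduct.tprod ℚ_[p]).toLinearMap (fun j => RescaledCompletion.of K p (w j) (hw j) (x j)) b with hφdef
  have hφ : ∀ δ, φ δ = PiTensorProduct.tprod ℚ_[p]
      (Function.update (fun j => RescaledCompletion.of K p (w j) (hw j) (x j)) b δ) := fun _ => rfl
  -- the box pure tensor itself, seen through `φ` at the slot value
  have hself : Function.update (fun j => RescaledCompletion.of K p (w j) (hw j) (x j)) b
      (RescaledCompletion.of K p (w b) (hw b) (x b)) = fun j => RescaledCompletion.of K p (w j) (hw j) (x j) :=
    Function.update_eq_self b _
  have hbx : φ (RescaledCompletion.of K p (w b) (hw b) (x b)) ∈ N := by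
    rw [hφ, hself]; exact hbox x hx
  -- the single-place five-element theorem at the singleton `{x b}`, through the pullback `N.comap φ`
  have hres := hmain {x b} (N.comap φ.toAddMonoidHom)
    (fun m hm => by
      obtain rfl := Set.eq_of_mem_singleton hm
      exact AddSubgroup.mem_comap.mpr hbx)
    (fun i' m hm => by
      obtain rfl := Set.eq_of_mem_singleton hm
      obtain ⟨k1, k2, k3, k4⟩ := horb i' x hx
      exact ⟨AddSubgroup.mem_comap.mpr k1, AddSubgroup.mem_comap.mpr k2,
        AddSubgroup.mem_comap.mpr k3, AddSubgroup.mem_comap.mpr k4⟩)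
    i (x b) (Set.mem_singleton _) ε ε'
  have h' : φ (y.coord (Sum.inr (i, ε)) (RescaledCompletion.of K p (w b) (hw b) (x b)) •
      y (Sum.inr (i, ε'))) ∈ N := AddSubgroup.mem_comap.mp hres
  rw [map_smul] at h'
  exact h'

/-! ## §2 The junction-friendly form: from closure under slot-`b` strip moves on pure tensors -/

omit [Fintype I] in
/-- **The slot reach from the orbit-closure hypothesis of `Thm311RealInd1StripPacketFloor` §1.**  Same data and conclusion as
`exists_slot_planes_tprod_mem_of_orbit`, with the four-image hypothesis replaced by: `N` is closed under ALL slot-`b` strip moves on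
pure tensors (`⊗ z ↦ (⊗ z)[b ↦ ψ₀(z_b)]`, `ψ₀ ∈ Real.ind1StripOf w_b (galoisLog w_b)` — p516014's factorwise `hg` at one slot).
The five memberships are two applications of the closure.  [claim: Mochizuki2012, status: disputed]
[cite: Mochizuki2012, IUTchIII Thm. 3.11 (i) p. 154] [cite: DupuyHilado2025, §4.9] -/
theorem exists_slot_planes_tprod_mem_of_closure (hJW : JannsenWingbergTwists)
    (b : I) (hp2 : p ≠ 2) (h3 : 3 ≤ localDeg K (w b)) (hodd : Odd (localDeg K (w b))) :
    ∃ (g : ℕ) (_ : localDeg K (w b) = 1 + 2 * g)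
      (y : Module.Basis (Fin 1 ⊕ Fin g × Fin 2) ℚ_[p] (RescaledCompletion K p (w b) (hw b)))
      (ψ ψ' : Fin g → ((w b).adicCompletion K ≃+ (w b).adicCompletion K)),
      (∀ i, ψ i ∈ ind1StripOf (w b) (galoisLog (w b))) ∧
      (∀ i, ψ' i ∈ ind1StripOf (w b) (galoisLog (w b))) ∧
      (∀ iε : Fin g × Fin 2, Algebra.trace ℚ_[p] (RescaledCompletion K p (w b) (hw b)) (y (Sum.inr iε)) = 0) ∧
      Submodule.span ℚ_[p] (Set.range fun iε : Fin g × Fin 2 => y (Sum.inr iε)) =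
        LinearMap.ker (Algebra.trace ℚ_[p] (RescaledCompletion K p (w b) (hw b))) ∧
      Algebra.trace ℚ_[p] (RescaledCompletion K p (w b) (hw b)) (y (Sum.inl 0)) ≠ 0 ∧
      ∀ (M : ∀ j, Set ((w j).adicCompletion K))
        (N : AddSubgroup (PacketAlgebra p fun j => RescaledCompletion K p (w j) (hw j))),
        (∀ x : Π j, (w j).adicCompletion K, (∀ j, x j ∈ M j) →
          PiTensorProduct.tprod ℚ_[p] (fun j => RescaledCompletion.of K p (w j) (hw j) (x j)) ∈ N) →
        (∀ ψ₀ ∈ ind1StripOf (w b) (galoisLog (w b)), ∀ z : Π j, RescaledCompletion K p (w j) (hw j),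
          PiTensorProduct.tprod ℚ_[p] z ∈ N →
            PiTensorProduct.tprod ℚ_[p] (Function.update z b (RescaledCompletion.of K p (w b) (hw b)
              (ψ₀ ((RescaledCompletion.of K p (w b) (hw b)).symm (z b))))) ∈ N) →
        ∀ (i : Fin g) (x : Π j, (w j).adicCompletion K), (∀ j, x j ∈ M j) → ∀ ε ε' : Fin 2,
          y.coord (Sum.inr (i, ε)) (RescaledCompletion.of K p (w b) (hw b) (x b)) •
            PiTensorProduct.tprod ℚ_[p] (Function.update (fun j => RescaledCompletion.of K p (w j) (hw j) (x j)) b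
              (y (Sum.inr (i, ε')))) ∈ N := by
  classical
  obtain ⟨g, hg, y, ψ, ψ', hψ, hψ', htr0, hspan, htr1, hmain⟩ :=
    exists_slot_planes_tprod_mem_of_orbit p w hw hJW b hp2 h3 hodd
  refine ⟨g, hg, y, ψ, ψ', hψ, hψ', htr0, hspan, htr1, fun M N hbox hN => ?_⟩
  refine hmain M N hbox (fun i' x' hx' => ?_)
  have hb0 : PiTensorProduct.tprod ℚ_[p] (fun j => RescaledCompletion.of K p (w j) (hw j) (x' j)) ∈ N :=
    hbox x' hx'
  have h1 := hN (ψ i') (hψ i') (fun j => RescaledCompletion.of K p (w j) (hw j) (x' j)) hb0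
  simp only [RingEquiv.symm_apply_apply] at h1
  have h2 := hN (ψ' i') (hψ' i') (fun j => RescaledCompletion.of K p (w j) (hw j) (x' j)) hb0
  simp only [RingEquiv.symm_apply_apply] at h2
  have h3 := hN (ψ' i') (hψ' i')
    (Function.update (fun j => RescaledCompletion.of K p (w j) (hw j) (x' j)) b
      (RescaledCompletion.of K p (w b) (hw b) (ψ i' (x' b)))) h1
  simp only [Function.update_self, Function.update_idem, RingEquiv.symm_apply_apply] at h3
  have h4 := hN (ψ i') (hψ i')
    (Function.update (fun j => RescaledCompletion.of K p (w j) (hw j) (x' j)) b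
      (RescaledCompletion.of K p (w b) (hw b) (ψ' i' (x' b)))) h2
  simp only [Function.update_self, Function.update_idem, RingEquiv.symm_apply_apply] at h4
  exact ⟨h1, h2, h3, h4⟩

/-! ## §3 The reach as a span: `AddSubgroup.closure (slot-`b` reach set) ≤ N` -/

omit [Fintype I] in
/-- **The quotable span form of the slot reach**: under the hypotheses of `exists_slot_planes_tprod_mem_of_orbit`, the additive
closure of the reach set `{y^*_{(i,ε)}(x_b) • (⊗_j x_j)[b ↦ y_{(i,ε')}] : x ∈ Π_j M_j, i, ε, ε'}` — additively the image lattice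
`Σ_i ⊗_{b' ≠ b} M_{b'} ⊗ C_i(M_b)·P_i^b` — lies in `N`: the span of the print-(Ind1) slot-`b` orbit of the box contains the
slot reach as a subgroup.  [claim: Mochizuki2012, status: disputed] [cite: Mochizuki2012, IUTchIII Thm. 3.11 (i) p. 154] -/
theorem closure_slot_planes_le_of_orbit (hJW : JannsenWingbergTwists)
    (b : I) (hp2 : p ≠ 2) (h3 : 3 ≤ localDeg K (w b)) (hodd : Odd (localDeg K (w b))) :
    ∃ (g : ℕ) (_ : localDeg K (w b) = 1 + 2 * g)
      (y : Module.Basis (Fin 1 ⊕ Fin g × Fin 2) ℚ_[p] (RescaledCompletion K p (w b) (hw b)))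
      (ψ ψ' : Fin g → ((w b).adicCompletion K ≃+ (w b).adicCompletion K)),
      (∀ i, ψ i ∈ ind1StripOf (w b) (galoisLog (w b))) ∧
      (∀ i, ψ' i ∈ ind1StripOf (w b) (galoisLog (w b))) ∧
      (∀ iε : Fin g × Fin 2, Algebra.trace ℚ_[p] (RescaledCompletion K p (w b) (hw b)) (y (Sum.inr iε)) = 0) ∧
      Submodule.span ℚ_[p] (Set.range fun iε : Fin g × Fin 2 => y (Sum.inr iε)) =
        LinearMap.ker (Algebra.trace ℚ_[p] (RescaledCompletion K p (w b) (hw b))) ∧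
      Algebra.trace ℚ_[p] (RescaledCompletion K p (w b) (hw b)) (y (Sum.inl 0)) ≠ 0 ∧
      ∀ (M : ∀ j, Set ((w j).adicCompletion K))
        (N : AddSubgroup (PacketAlgebra p fun j => RescaledCompletion K p (w j) (hw j))),
        (∀ x : Π j, (w j).adicCompletion K, (∀ j, x j ∈ M j) →
          PiTensorProduct.tprod ℚ_[p] (fun j => RescaledCompletion.of K p (w j) (hw j) (x j)) ∈ N) →
        (∀ (i : Fin g) (x : Π j, (w j).adicCompletion K), (∀ j, x j ∈ M j) →
          PiTensorProduct.tprod ℚ_[p] (Function.update (fun j => RescaledCompletion.of K p (w j) (hw j) (x j)) b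
            (RescaledCompletion.of K p (w b) (hw b) (ψ i (x b)))) ∈ N ∧
          PiTensorProduct.tprod ℚ_[p] (Function.update (fun j => RescaledCompletion.of K p (w j) (hw j) (x j)) b
            (RescaledCompletion.of K p (w b) (hw b) (ψ' i (x b)))) ∈ N ∧
          PiTensorProduct.tprod ℚ_[p] (Function.update (fun j => RescaledCompletion.of K p (w j) (hw j) (x j)) b
            (RescaledCompletion.of K p (w b) (hw b) (ψ' i (ψ i (x b))))) ∈ N ∧
          PiTensorProduct.tprod ℚ_[p] (Function.update (fun j => RescaledCompletion.of K p (w j) (hw j) (x j)) b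
            (RescaledCompletion.of K p (w b) (hw b) (ψ i (ψ' i (x b))))) ∈ N) →
        AddSubgroup.closure
          {t : PacketAlgebra p fun j => RescaledCompletion K p (w j) (hw j) |
            ∃ (i : Fin g) (ε ε' : Fin 2) (x : Π j, (w j).adicCompletion K), (∀ j, x j ∈ M j) ∧
              t = y.coord (Sum.inr (i, ε)) (RescaledCompletion.of K p (w b) (hw b) (x b)) •
                PiTensorProduct.tprod ℚ_[p] (Function.update (fun j => RescaledCompletion.of K p (w j) (hw j) (x j)) b
                  (y (Sum.inr (i, ε'))))} ≤ N := by
  classical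
  obtain ⟨g, hg, y, ψ, ψ', hψ, hψ', htr0, hspan, htr1, hmain⟩ :=
    exists_slot_planes_tprod_mem_of_orbit p w hw hJW b hp2 h3 hodd
  refine ⟨g, hg, y, ψ, ψ', hψ, hψ', htr0, hspan, htr1, fun M N hbox horb => ?_⟩
  rw [AddSubgroup.closure_le]
  rintro t ⟨i, ε, ε', x, hx, rfl⟩
  exact hmain M N hbox horb i x hx ε ε'

/-! ## §4 Consistency with the packet ceiling: every reached vector is trace-zero in `X` -/

omit [DecidableEq I] in
/-- **A pure tensor with one trace-zero slot is trace-zero in the packet** (UNCONDITIONAL):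
`Tr_X(⊗_j z_j) = Π_j Tr(z_j) = 0` when `Tr(z_b) = 0` (`trace_purePacket`, abc-iut-S6).  Applied to the reached vectors of the slot
reach (slot `b` carries a plane vector, trace-zero), this places the whole reach inside the packet ceiling
`M + c·(log_p(R_I^×) ∩ Ker Tr_X)` of `Thm311RealInd1StripPacketCeiling` — the lower bound is consistent with the upper.
[claim: Mochizuki2012, status: disputed] [cite: Mochizuki2012, IUTchIV Prop. 1.2 p. 10] -/
theorem trace_tprod_eq_zero_of_slot (b : I) (z : Π j, RescaledCompletion K p (w j) (hw j))
    (hzb : Algebra.trace ℚ_[p] (RescaledCompletion K p (w b) (hw b)) (z b) = 0) :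
    Algebra.trace ℚ_[p] (PacketAlgebra p fun j => RescaledCompletion K p (w j) (hw j))
      (PiTensorProduct.tprod ℚ_[p] z) = 0 := by
  have h := trace_purePacket p (fun j => RescaledCompletion K p (w j) (hw j)) z
  rw [show purePacket p (fun j => RescaledCompletion K p (w j) (hw j)) z =
      PiTensorProduct.tprod ℚ_[p] z from rfl] at h
  rw [h]
  exact Finset.prod_eq_zero (Finset.mem_univ b) hzb

omit [DecidableEq I] in
/-- Scalar form: the reached vectors `c • (⊗_j z_j)[b ↦ y_{(i,ε')}]` are trace-zero (trace is `ℚ_p`-linear).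
[claim: Mochizuki2012, status: disputed] [cite: Mochizuki2012, IUTchIV Prop. 1.2 p. 10] -/
theorem trace_smul_tprod_eq_zero_of_slot (b : I) (c : ℚ_[p]) (z : Π j, RescaledCompletion K p (w j) (hw j))
    (hzb : Algebra.trace ℚ_[p] (RescaledCompletion K p (w b) (hw b)) (z b) = 0) :
    Algebra.trace ℚ_[p] (PacketAlgebra p fun j => RescaledCompletion K p (w j) (hw j))
      (c • PiTensorProduct.tprod ℚ_[p] z) = 0 := by
  rw [map_smul, trace_tprod_eq_zero_of_slot p w hw b z hzb, smul_zero]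

end Summit.ABC.IUTFork.Thm311.Real
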